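import Literature.NumberTheory.GaloisRepresentations.GlobalReciprocity
import Literature.NumberTheory.GaloisRepresentations.LocalOneUnitsNumberFieldProofs
import Literature.NumberTheory.EllipticCurves.ZpExtensionIdelicProofs
import Literature.NumberTheory.EllipticCurves.ZpExtensionLatticeProofs
import Literature.NumberTheory.EllipticCurves.ZpExtensionKroneckerWeberProofs
import HarnessLib

/-!
# The anticyclotomic `ℤ_p`-extension from Kronecker–Weber and the global reciprocity law (proofs)

Topic `NumberTheory/EllipticCurves` (Iwasawa theory of `ℤ_p`-extensions); namespace
`Literature.NumberTheory.EllipticCurves.ZpExtension`.  No new definitions.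

This file discharges the `K`-side input of `Literature.NumberTheory.EllipticCurves.ZpExtension.exists_isAnticyclotomic` — two
jointly surjective continuous characters `κ₁, κ₂ : Γ_K →ₜ* ℤ_p` of an imaginary quadratic field
`K`, i.e. "`Gal(K̃/K) ↠ ℤ_p²`" (the existence half of Washington's Thm. 13.4 /
`zpRank_eq_nrComplexPlaces_add_one K p`) — from the **global reciprocity law** in the
existential form of the named fact `Literature.exists_isGlobalReciprocityMap K`
(`GlobalReciprocity.lean`: a continuous surjection `θ : C_K → Γ_K^ab` with kernel the infinitely
divisible classes, under which open subgroups of finite index are preimages of open subgroups).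
Everything else is proved:

1. `LocalOneUnitsNumberFieldProofs`: for `v ∣ p`, `n_v` continuous characters `𝒪_vˣ → ℤ_p` with
   open joint image, `p^{n_v} = #(𝒪_v/p)`, and `[K:ℚ] ≤ ∑_{v∣p} n_v`;
2. `ZpExtensionIdelicProofs` (`Literature.NumberTheory.EllipticCurves.exists_idelicCharacters`, with `UnitIdeles.lean`): `m ≥ [K:ℚ]` continuous characters
   `χ_j : 𝕀_K → ℤ_p` trivial on `Kˣ` with joint image `⊇ p^M ℤ_p^m` (class number + finite unit
   group; this is Washington's exact sequence `Ē → ∏ U_𝔭 → Gal → Cl`);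
3. here (`exists_characters_of_idelicCharacters`): `χ_j` descends to `C_K`, kills `ker θ` (`ℤ_p` has no infinitely divisible elements),
   hence factors through `θ` as a *continuous* character of `Γ_K^ab` (continuity from the
   existence theorem clause), and composing with `Γ_K → Γ_K^ab` gives `m` characters of `Γ_K`
   with joint image `⊇ p^M ℤ_p^m` (`exists_characters_of_globalReciprocity`);
4. `ZpExtensionLatticeProofs`: re-basing to `m ≥ 2` jointly surjective characters, of which we
   keep two (`exists_pair_of_globalReciprocity`);
5. with the `ℚ`-side from Kronecker–Weber (`dependent_of_kroneckerWeber`) and the index-two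
   descent of `ZpExtensionDihedralProofs`/`ZpExtensionProofs`:
   `exists_isAnticyclotomic_of_kroneckerWeber_of_globalReciprocity :
     KroneckerWeber → exists_isGlobalReciprocityMap K → exists_isAnticyclotomic`.

So `exists_isAnticyclotomic` is reduced to the two classical named facts `KroneckerWeber`
(Washington Thm. 14.1) and `exists_isGlobalReciprocityMap` (Neukirch, Bonn Lectures III (7.12);
Tate, Cassels–Fröhlich VII §5).

## References

* L. C. Washington, *Introduction to Cyclotomic Fields*, 2nd ed., GTM 83, §13.1, Thm. 13.4 and
  its proof (p. 265–266).
* S. Lang, *Cyclotomic Fields I and II*, GTM 121, Ch. 5 §5, Thm. 5.1–5.2.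
* R. Greenberg, in *Analytic number theory and Diophantine problems*, Progr. Math. 70 (1987), §2.
* J. Neukirch, *Class Field Theory — The Bonn Lectures* (2013), Part III (7.12).
-/

noncomputable section

open NumberField IsDedekindDomain Field Topology

namespace Literature.NumberTheory.EllipticCurves

namespace ZpExtension

universe u

variable {K : Type u} [Field K] [NumberField K] {p : ℕ} [Fact p.Prime]

/-- `ℤ_p` has no non-zero infinitely divisible elements: if `z ∈ p^k ℤ_p` for all `k` then
`z = 0`; multiplicatively, for `Multiplicative ℤ_p`. [folklore] -/
theorem multiplicative_padicInt_eq_one_of_forall_pow (z : Multiplicative ℤ_[p])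
    (hz : ∀ n : ℕ, 0 < n → ∃ b : Multiplicative ℤ_[p], b ^ n = z) : z = 1 := by
  apply Multiplicative.toAdd.injective
  rw [toAdd_one, ← PadicInt.ext_of_toZModPow]
  intro k
  obtain ⟨b, hb⟩ := hz (p ^ k) (pow_pos (Fact.out : p.Prime).pos k)
  rw [map_zero, ← hb, toAdd_pow, nsmul_eq_mul, map_mul, map_natCast, ZMod.natCast_self, zero_mul]

/-- The subgroup `p^k ℤ_p ⊆ Multiplicative ℤ_p` is open. [folklore] -/
theorem isOpen_toSubgroup_span_pow (k : ℕ) :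
    IsOpen (((Ideal.span {(p : ℤ_[p]) ^ k}).toAddSubgroup.toSubgroup' :
      Subgroup (Multiplicative ℤ_[p])) : Set (Multiplicative ℤ_[p])) := by
  have h : (((Ideal.span {(p : ℤ_[p]) ^ k}).toAddSubgroup.toSubgroup' :
      Subgroup (Multiplicative ℤ_[p])) : Set (Multiplicative ℤ_[p])) =
      Multiplicative.toAdd ⁻¹' {z : ℤ_[p] | PadicInt.toZModPow k z = 0} := by
    ext z
    simp only [SetLike.mem_coe, Set.mem_preimage, Set.mem_setOf_eq, ← RingHom.mem_ker,
      PadicInt.ker_toZModPow]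
    rfl
  rw [h]
  exact (GaloisRepresentations.OneUnits.isOpen_setOf_toZModPow_eq p k 0).preimage continuous_toAdd

/-- **Transport of idelic characters to `Γ_K` along a global reciprocity map** (explicit
form).  Let `θ : C_K → Γ_K^ab` be a global reciprocity map (`IsGlobalReciprocityMap`) and
`χ_j : 𝕀_K → ℤ_p` continuous characters trivial on `Kˣ`.  Then there are continuous characters
`κ_j : Γ_K →ₜ* ℤ_p` with `κ_j(σ) = χ_j(x)` whenever `σ|_{K^ab} = θ(x Kˣ)`: `χ_j` descends to `C_K`,
kills `ker θ` (infinitely divisible classes; `ℤ_p` is reduced), hence factors through `θ`,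
continuously because open subgroups of finite index have open image (existence theorem), and is
then composed with `Γ_K → Γ_K^ab`.  (Every class `θ(x Kˣ)` is some `σ|_{K^ab}`,
`QuotientGroup.mk'_surjective`.)
Ref: Washington, *Introduction to Cyclotomic Fields*, §13.1, proof of Thm. 13.4; Lang,
*Cyclotomic Fields I and II*, Ch. 5 §5, Thm. 5.1. [folklore] -/
theorem exists_characters_of_idelicCharacters
    {θ : GaloisRepresentations.ideleGroup K ⧸ GaloisRepresentations.principalIdeles K →* absoluteGaloisGroupAbelianization K}
    (hθ : GaloisRepresentations.IsGlobalReciprocityMap K θ) {J : Type*}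
    (χ : J → (GaloisRepresentations.ideleGroup K →ₜ* Multiplicative ℤ_[p]))
    (hprinc : ∀ j, ∀ x ∈ GaloisRepresentations.principalIdeles K, χ j x = 1) :
    ∃ κ : J → (absoluteGaloisGroup K →ₜ* Multiplicative ℤ_[p]),
      ∀ j (σ : absoluteGaloisGroup K) (x : GaloisRepresentations.ideleGroup K),
        QuotientGroup.mk' (commutator (absoluteGaloisGroup K)).topologicalClosure σ =
          θ (x : GaloisRepresentations.ideleGroup K ⧸ GaloisRepresentations.principalIdeles K) → κ j σ = χ j x := by
  classical
  -- Step 2: descend to `C_K`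
  let χbar : J → (GaloisRepresentations.ideleGroup K ⧸ GaloisRepresentations.principalIdeles K →* Multiplicative ℤ_[p]) := fun j =>
    QuotientGroup.lift (GaloisRepresentations.principalIdeles K) (χ j).toMonoidHom fun x hx => hprinc j x hx
  have hχbar_mk : ∀ j (x : GaloisRepresentations.ideleGroup K), χbar j (x : GaloisRepresentations.ideleGroup K ⧸ GaloisRepresentations.principalIdeles K) = χ j x :=
    fun j x => rfl
  have hχbar_cont : ∀ j, Continuous (χbar j) := fun j =>
    (QuotientGroup.isQuotientMap_mk _).continuous_iff.2 (χ j).continuous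
  -- Step 3: factor through `θ`
  have hker : ∀ j (c : GaloisRepresentations.ideleGroup K ⧸ GaloisRepresentations.principalIdeles K), θ c = 1 → χbar j c = 1 := fun j c hc =>
    hθ.map_eq_one_of_map_eq_one (fun z hz => multiplicative_padicInt_eq_one_of_forall_pow z hz)
      (χbar j) hc
  choose s hs using hθ.surjective
  let ψ : J → absoluteGaloisGroupAbelianization K → Multiplicative ℤ_[p] := fun j g => χbar j (s g)
  have hψθ : ∀ j c, ψ j (θ c) = χbar j c := fun j c => by
    change χbar j (s (θ c)) = χbar j c
    have h1 : θ (s (θ c) * c⁻¹) = 1 := by rw [map_mul, map_inv, hs, mul_inv_cancel]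
    have h2 := hker j _ h1
    rwa [map_mul, map_inv, mul_inv_eq_one] at h2
  have hψ_mul : ∀ j g g', ψ j (g * g') = ψ j g * ψ j g' := fun j g g' => by
    obtain ⟨c, rfl⟩ := hθ.surjective g
    obtain ⟨c', rfl⟩ := hθ.surjective g'
    rw [← map_mul, hψθ, hψθ, hψθ, map_mul]
  have hψ_one : ∀ j, ψ j 1 = 1 := fun j => by
    rw [← map_one θ, hψθ, map_one]
  -- continuity of `ψ j`
  have hψ_cont : ∀ j, Continuous (ψ j) := fun j => by
    have hadd : Continuous fun g => (ψ j g).toAdd := by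
      refine GaloisRepresentations.OneUnits.continuous_of_toZModPow_eventually_eq p fun k g₀ => ?_
      -- the open finite-index subgroup `N = χbar⁻¹(p^k ℤ_p)` of `C_K`
      let Pk : Subgroup (Multiplicative ℤ_[p]) :=
        (Ideal.span {(p : ℤ_[p]) ^ k}).toAddSubgroup.toSubgroup'
      have hPk_mem : ∀ z : Multiplicative ℤ_[p], z ∈ Pk ↔ PadicInt.toZModPow k z.toAdd = 0 := fun z => by
        rw [← RingHom.mem_ker, PadicInt.ker_toZModPow]; rfl
      let N : Subgroup (GaloisRepresentations.ideleGroup K ⧸ GaloisRepresentations.principalIdeles K) := Pk.comap (χbar j)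
      have hNopen : IsOpen (N : Set (GaloisRepresentations.ideleGroup K ⧸ GaloisRepresentations.principalIdeles K)) :=
        (isOpen_toSubgroup_span_pow k).preimage (hχbar_cont j)
      have hNfi : N.FiniteIndex := by
        let f : (GaloisRepresentations.ideleGroup K ⧸ GaloisRepresentations.principalIdeles K) →* Multiplicative (ZMod (p ^ k)) :=
          (AddMonoidHom.toMultiplicative (PadicInt.toZModPow k).toAddMonoidHom).comp (χbar j)
        have hNf : N = f.ker := by
          ext c
          simp only [N, Subgroup.mem_comap, MonoidHom.mem_ker, hPk_mem]
          rfl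
        rw [hNf]
        haveI : Finite f.range := inferInstance
        exact @Subgroup.finiteIndex_of_finite_quotient _ _ _
          (Finite.of_equiv f.range (QuotientGroup.quotientKerEquivRange f).symm)
      have hθN : IsOpen (θ '' (N : Set (GaloisRepresentations.ideleGroup K ⧸ GaloisRepresentations.principalIdeles K))) :=
        hθ.isOpen_image hNopen hNfi
      -- `g₀ · θ(N)` is an open neighbourhood of `g₀` on which `ψ j ≡ ψ j g₀ (mod p^k)`
      have hmem : g₀ ∈ (fun g => g₀ * g) '' (θ '' (N : Set _)) :=
        ⟨1, ⟨1, N.one_mem, map_one θ⟩, mul_one g₀⟩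
      filter_upwards [((isOpenMap_mul_left g₀) _ hθN).mem_nhds hmem] with g hg
      obtain ⟨_, ⟨c, hc, rfl⟩, rfl⟩ := hg
      rw [hψ_mul, toAdd_mul, map_add, add_eq_left]
      rw [hψθ]
      exact (hPk_mem _).1 hc
    have : ψ j = fun g => Multiplicative.ofAdd ((ψ j g).toAdd) := funext fun g => rfl
    rw [this]
    exact continuous_ofAdd.comp hadd
  let ψh : J → (absoluteGaloisGroupAbelianization K →ₜ* Multiplicative ℤ_[p]) := fun j =>
    { toFun := ψ j
      map_one' := hψ_one j
      map_mul' := hψ_mul j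
      continuous_toFun := hψ_cont j }
  -- Step 4: compose with `Γ_K → Γ_K^ab`
  let π : absoluteGaloisGroup K →* absoluteGaloisGroupAbelianization K :=
    QuotientGroup.mk' (commutator (absoluteGaloisGroup K)).topologicalClosure
  have hπ : Continuous π := QuotientGroup.continuous_mk
  let κ : J → (absoluteGaloisGroup K →ₜ* Multiplicative ℤ_[p]) := fun j =>
    (ψh j).comp ⟨π, hπ⟩
  refine ⟨κ, fun j σ x hσ => ?_⟩
  change ψ j (π σ) = _
  change π σ = θ _ at hσ
  rw [hσ, hψθ, hχbar_mk]

/-- **Characters of `Γ_K` from the global reciprocity law.**  Let `K` be a number field of unit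
rank `0` and `θ : C_K → Γ_K^ab` a global reciprocity map (`IsGlobalReciprocityMap`).  Then there
are `m ≥ [K : ℚ]` continuous characters `κ_j : Γ_K →ₜ* ℤ_p` whose joint image contains
`p^M ℤ_p^m`: the idelic characters `χ_j : 𝕀_K/Kˣ → ℤ_p` of `exists_idelicCharacters`, transported
by `exists_characters_of_idelicCharacters`.
Ref: Washington, *Introduction to Cyclotomic Fields*, §13.1, proof of Thm. 13.4; Lang,
*Cyclotomic Fields I and II*, Ch. 5 §5, Thm. 5.1. [folklore] -/
theorem exists_characters_of_globalReciprocity (h0 : NumberField.Units.rank K = 0)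
    {θ : GaloisRepresentations.ideleGroup K ⧸ GaloisRepresentations.principalIdeles K →* absoluteGaloisGroupAbelianization K}
    (hθ : GaloisRepresentations.IsGlobalReciprocityMap K θ) :
    ∃ (m M : ℕ) (κ : Fin m → (absoluteGaloisGroup K →ₜ* Multiplicative ℤ_[p])),
      Module.finrank ℚ K ≤ m ∧
      ∀ y : Fin m → ℤ_[p], ∃ σ : absoluteGaloisGroup K, ∀ j,
        (κ j σ).toAdd = (p : ℤ_[p]) ^ M * y j := by
  classical
  obtain ⟨m, M, χ, hm, hprinc, hsurj⟩ := exists_idelicCharacters (K := K) p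
    (isOfFinOrder_units_of_rank_eq_zero h0)
    (fun v hv => GaloisRepresentations.OneUnits.exists_continuousMonoidHom_adicCompletionIntegers K v p hv)
    (fun T hT n hn => GaloisRepresentations.OneUnits.finrank_le_sum K p T hT n hn)
  obtain ⟨κ, hκ⟩ := exists_characters_of_idelicCharacters (p := p) hθ χ hprinc
  refine ⟨m, M, κ, hm, fun y => ?_⟩
  obtain ⟨x, hx⟩ := hsurj y
  obtain ⟨σ, hσ⟩ := QuotientGroup.mk'_surjective
    (commutator (absoluteGaloisGroup K)).topologicalClosure (θ (x : GaloisRepresentations.ideleGroup K ⧸ GaloisRepresentations.principalIdeles K))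
  exact ⟨σ, fun j => by rw [hκ j σ x hσ, hx j]⟩

/-- **Two jointly surjective characters of `Γ_K` for `K` imaginary quadratic, from the global
reciprocity law** — the existence half of "`Gal(K̃/K) ≃ ℤ_p²`" (Greenberg (1987) §2; Washington
Thm. 13.4 with `r₂ = 1`, Leopoldt trivial): the `m ≥ [K:ℚ] = 2` characters of
`exists_characters_of_globalReciprocity` are re-based to jointly surjective ones
(`exists_surjective_of_forall_exists`) and two of them are kept.
Ref: Greenberg (1987), §2; Washington, *Introduction to Cyclotomic Fields*, Thm. 13.4.
[folklore] -/
theorem exists_pair_of_globalReciprocity (hK : Module.finrank ℚ K = 2)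
    (h0 : NumberField.Units.rank K = 0) (hGR : GaloisRepresentations.exists_isGlobalReciprocityMap K) :
    ∃ κ₁ κ₂ : absoluteGaloisGroup K →ₜ* Multiplicative ℤ_[p],
      Function.Surjective fun σ => ((κ₁ σ).toAdd, (κ₂ σ).toAdd) := by
  obtain ⟨θ, hθ⟩ := hGR
  obtain ⟨m, M, κ, hm, hsurj⟩ := exists_characters_of_globalReciprocity (p := p) h0 hθ
  obtain ⟨κ', hκ'⟩ := exists_surjective_of_forall_exists κ M hsurj
  have h2 : 2 ≤ m := hK ▸ hm
  refine ⟨κ' ⟨0, by omega⟩, κ' ⟨1, by omega⟩, fun yz => ?_⟩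
  obtain ⟨σ, hσ⟩ := hκ' fun i => if i.1 = 0 then yz.1 else yz.2
  refine ⟨σ, Prod.ext ?_ ?_⟩
  · have := congrFun hσ ⟨0, by omega⟩
    simpa using this
  · have := congrFun hσ ⟨1, by omega⟩
    simpa using this

open NumberField.InfinitePlace in
/-- **The anticyclotomic `ℤ_p`-extension exists, given Kronecker–Weber and the global reciprocity
law.**  For `K` imaginary quadratic, `Literature.NumberTheory.EllipticCurves.ZpExtension.exists_isAnticyclotomic` follows from the
named facts `KroneckerWeber` (Washington Thm. 14.1; supplying rank `≤ 1` for `Γ_ℚ`,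
`dependent_of_kroneckerWeber`) and `exists_isGlobalReciprocityMap K` (Neukirch, Bonn Lectures III
(7.12); Tate, Cassels–Fröhlich VII §5; supplying two jointly surjective characters of `Γ_K`,
`exists_pair_of_globalReciprocity`, everything between being proved), via the index-two descent
`IndexTwo.exists_surjective_anticyclotomic` and the Galois glue of `ZpExtensionProofs.lean`.
Compared with `exists_isAnticyclotomic_of_kroneckerWeber`, the class-field-theoretic `ℤ_p`-rank
fact for `K` (`zpRank_eq_nrComplexPlaces_add_one K p`) is replaced by the global reciprocity law
itself.  Ref: Greenberg (1987), §2; Washington, §13.1, Thm. 13.4, Thm. 14.1.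
[cite: Greenberg1987, §2] -/
theorem exists_isAnticyclotomic_of_kroneckerWeber_of_globalReciprocity (hKW : GaloisRepresentations.KroneckerWeber)
    (hGR : GaloisRepresentations.exists_isGlobalReciprocityMap K) :
    exists_isAnticyclotomic (K := K) (p := p) := by
  intro _ hK himag
  obtain ⟨c, hc, hc2⟩ := exists_not_mem_range_absGaloisRestrict K (Rat.castHom ℝ) himag
  have hH := exists_pair_of_globalReciprocity (p := p) hK
    (units_rank_eq_zero_of_finrank_eq_two hK himag) hGR
  obtain ⟨κ, hsurj, hanti⟩ := IndexTwo.exists_surjective_anticyclotomic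
    (GaloisRepresentations.absGaloisRestrict_injective ℚ K) hc hc2
    (fun ρ ρ' hρ hρ' => inv_mul_mem_range_absGaloisRestrict hK hρ hρ')
    (dependent_of_kroneckerWeber hKW) hH
  exact ⟨⟨κ, hsurj⟩, fun σ τ ρ hρ h => hanti σ τ ρ hρ h⟩

end ZpExtension

end Literature.NumberTheory.EllipticCurves
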